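import Literature.NumberTheory.Rogawski1990.LocalTransferLinear
import Literature.NumberTheory.Rogawski1990.LocalTransferExistence
import Literature.NumberTheory.Rogawski1990.GlobalTransferFactor
import Literature.NumberTheory.Rogawski1990.TransferFactsCanonical
import Literature.NumberTheory.Rogawski1990.StableClassRegular
import Literature.NumberTheory.Automorphic.OrbitalMeasureCanonical
import Literature.NumberTheory.Automorphic.UnitaryGroupPatchedFamiliesSingular
import HarnessLib

/-!
# PATCH-SAFETY of the regular-class pins: every ED ≤ 1.23 conjunct of the T1 line that reads a local ∕ archimedean orbital measure family reads it only at
# the REGULAR classes, so it transfers VERBATIM to any family with the same regular members (Rogawski (1990), §4.3 (4.3.1) p. 43, §14.2 (14.2.1) p. 232, §14.3 p. 234)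

Topic `NumberTheory/Automorphic`; namespaces `Literature.NumberTheory.Automorphic` (§1, abstract groups) and `Literature.NumberTheory.Automorphic.UnitaryGroup`
(§2, the CM carriers); THEOREMS ONLY (no definition, no instance, no named fact, no `sorry`).  Cell `pub/hodgecm-mathlib`, ENGINE T1 line
`F0_T1InnerFormTraceIdentity` (crux item stmt-HodgeConjecture-24833), row **(F-1) «SET ∕ (A-s) ANCHOR FOLD»** (O7 OWNER WORD #31, 2026-08-31T12:18:16Z): the ED 1.24
anchor replaces the kit's families `m_{G′,v}`, `m_{G′,∞}`, `m_∞` by the DITE-PATCHED families «regular class ↦ the canonical member, non-regular class ↦ the member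
of the singular package» (F0P3a-plan RULING #115 (F1′)); this file is the patch-safety certificate: each regular-class predicate of the line holds for the patched
family as soon as it holds for the canonical one.  The hypothesis throughout is AGREEMENT ON THE `P`-CLASSES, `∀ c, P (out c) → m′ c = m c` (for the dite patch:
`if_pos`), never a definition of the patch — so the lemmas serve any future re-patching too.

WHY.  ★ `IsAdmissibleOn P` ∕ `IsQuotientOf P` ∕ `IsCanonical P` quantify `∀ c, P (out c) → …(m c)…` (§1: rewrite under the guard); ★ `stableOrbitalIntegralRel st m f γ`
sums `m c` over the classes stably conjugate to `γ`, regular when `γ` is (★ `IsStablyConj.isRegularElt_iff`, ★ `isRegularElt_iff_of_corresponds`), so (14.2.1) ★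
`IsInnerTransferRel` reads regular members only; ★ `IsDeltaTransferRel R … T mH mG` sums `T.Δ a (out c) · Φ(mG; c)` over ALL classes, but `T.Δ a b = 0` unless `R a b`
(★ `TransferFactorData.eq_zero_of_not_rel`) and a norm pair with `G`-regular source has regular target (★ `isRegularElt_of_isLocalNormPair` ∕ `…ArchNormPair`).  §2
instantiates at a finite place (★ `IsLocalDeltaTransfer(Exists)`, ★ `IsLocalTransferDatum`, ★ `IsLocalUnitTransfer`) and at `∞` (★ `IsArchInnerTransfer(Exists)`, ★
`IsArchDeltaTransfer(Exists)`); §3: the four family riders (ix-adm)(ix-admA)(ix-admAq)(ix-norm) of the T1b-singular closer at a NON-regular `γ₀` pass from the singular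
members to any family agreeing with them OFF the regular classes (★ `isNormalisedOff_congr_point` for (ix-norm)).
HC_CM is proved only modulo the printed citations (7 + the (xv)∕(xv-s) package clauses) until rung 0 closes; this file proves no printed citation.

References: J. D. Rogawski, *Automorphic Representations of Unitary Groups in Three Variables* (1990), §4.1 (4.1.1) p. 39, §4.3 (4.3.1) p. 43, §4.9 Prop. 4.9.1
p. 55, §14.2 (14.2.1) p. 232, §14.3 pp. 233–234 [Rogawski1990]; A. Deitmar, S. Echterhoff, *Principles of Harmonic Analysis* (2014), Thm. 1.5.3 [DeitmarEchterhoff2014].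
-/

set_option autoImplicit false
noncomputable section
open MeasureTheory Measure Set Topology NumberField IsDedekindDomain
open Literature.MeasureTheory.Group Literature.NumberTheory.Rogawski1990
open scoped ENNReal NNReal Matrix MatrixGroups

namespace Literature.NumberTheory.Automorphic

/-! ## §1 Abstract groups -/
section ClassPredicates

variable {G : Type*} [Group G] [TopologicalSpace G] [∀ γ : G, MeasurableSpace (G ⧸ Subgroup.centralizer ({γ} : Set G))]

/-- **Admissibility on the `P`-classes transfers along agreement on the `P`-classes.** [cite: Rogawski1990, §14.2 (14.2.1) p. 232] -/
theorem OrbitalMeasureFamily.isAdmissibleOn_of_eqOn {P : G → Prop} {m m' : OrbitalMeasureFamily G}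
    (h : ∀ c : ConjClasses G, P (Quotient.out c) → m' c = m c) (hm : m.IsAdmissibleOn P) : m'.IsAdmissibleOn P := fun c hc => by
  rw [h c hc]
  exact hm c hc

end ClassPredicates

section StableSums

variable {G : Type*} [Group G] [∀ γ : G, MeasurableSpace (G ⧸ Subgroup.centralizer ({γ} : Set G))]

/-- **The class orbital integral reads the family at one class.** [cite: Rogawski1990, §4.1 (4.1.1) p. 39] -/
theorem classOrbitalIntegral_congr_of_eq {m m' : OrbitalMeasureFamily G} {c : ConjClasses G} (h : m' c = m c) (f : G → ℂ) :
    classOrbitalIntegral m' f c = classOrbitalIntegral m f c := by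
  rw [classOrbitalIntegral_eq, classOrbitalIntegral_eq, h]

/-- **The stable orbital integral `Φ^{st}(γ, f)` reads the family only at the classes `c` with `st γ (out c)`.** [cite: Rogawski1990, §4.1 (4.1.1) p. 39] -/
theorem stableOrbitalIntegralRel_congr_of_eqOn {st : G → G → Prop} {m m' : OrbitalMeasureFamily G} {γ : G}
    (h : ∀ c : ConjClasses G, st γ (Quotient.out c) → m' c = m c) (f : G → ℂ) :
    stableOrbitalIntegralRel st m' f γ = stableOrbitalIntegralRel st m f γ := by
  rw [stableOrbitalIntegralRel_def, stableOrbitalIntegralRel_def]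
  exact finsum_mem_congr rfl fun c hc => classOrbitalIntegral_congr_of_eq (h c hc) f

end StableSums

section WeilForm

variable {G : Type*} [Group G] [TopologicalSpace G] [IsTopologicalGroup G] [LocallyCompactSpace G] [SecondCountableTopology G]
  [T2Space G] [MeasurableSpace G] [BorelSpace G]
  [∀ γ : G, MeasurableSpace (G ⧸ Subgroup.centralizer ({γ} : Set G))]
  [∀ γ : G, BorelSpace (G ⧸ Subgroup.centralizer ({γ} : Set G))]

/-- **Weil form on the `P`-classes transfers along agreement on the `P`-classes.** [cite: Rogawski1990, §4.3 (4.3.1) p. 43] [cite: DeitmarEchterhoff2014, Thm. 1.5.3] -/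
theorem OrbitalMeasureFamily.isQuotientOf_of_eqOn {P : G → Prop} (ν : Measure G) [IsFiniteMeasureOnCompacts ν] [ν.IsMulRightInvariant]
    (t : ∀ γ : G, Measure (Subgroup.centralizer ({γ} : Set G))) {m m' : OrbitalMeasureFamily G}
    (h : ∀ c : ConjClasses G, P (Quotient.out c) → m' c = m c) (hm : m.IsQuotientOf P ν t) : m'.IsQuotientOf P ν t := fun c hc => by
  rw [h c hc]
  exact hm c hc

/-- **Canonicity on the `P`-classes transfers along agreement on the `P`-classes.** [cite: Rogawski1990, §4.3 (4.3.1) p. 43] [cite: DeitmarEchterhoff2014, Thm. 1.5.3] -/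
theorem OrbitalMeasureFamily.isCanonical_of_eqOn {P : G → Prop} (ν : Measure G) [IsFiniteMeasureOnCompacts ν] [ν.IsMulRightInvariant]
    {m m' : OrbitalMeasureFamily G}
    (h : ∀ c : ConjClasses G, P (Quotient.out c) → m' c = m c) (hm : m.IsCanonical P ν) : m'.IsCanonical P ν := fun c hc => by
  rw [h c hc]
  exact hm c hc

end WeilForm

section Relations

variable {A B : Type*} [Group A] [Group B]
  [∀ a : A, MeasurableSpace (A ⧸ Subgroup.centralizer ({a} : Set A))]
  [∀ b : B, MeasurableSpace (B ⧸ Subgroup.centralizer ({b} : Set B))]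

/-- **(14.2.1) is PATCH-SAFE**: agreement of `m′₂`∕`m′` at the `B`-classes stably conjugate to some `γ′ ↔ γ`, `regA γ`, and of `m₂`∕`m` at the `A`-classes
stably conjugate to a regular `γ` suffices. [cite: Rogawski1990, §14.2 (14.2.1) p. 232] -/
theorem IsInnerTransferRel.iff_of_eqOn {corr : B → A → Prop} {stB : B → B → Prop} {stA : A → A → Prop} {regA : A → Prop}
    {m' m'₂ : OrbitalMeasureFamily B} {m m₂ : OrbitalMeasureFamily A}
    (hB : ∀ (γ : A) (γ' : B), regA γ → corr γ' γ → ∀ c : ConjClasses B, stB γ' (Quotient.out c) → m'₂ c = m' c)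
    (hA : ∀ γ : A, regA γ → ∀ c : ConjClasses A, stA γ (Quotient.out c) → m₂ c = m c) (f' : B → ℂ) (f : A → ℂ) :
    IsInnerTransferRel corr stB stA regA m' m f' f ↔ IsInnerTransferRel corr stB stA regA m'₂ m₂ f' f := by
  refine forall_congr' fun γ => forall_congr' fun hγ => ?_
  rw [stableOrbitalIntegralRel_congr_of_eqOn (hA γ hγ) f]
  refine and_congr (forall_congr' fun γ' => forall_congr' fun hc => ?_) Iff.rfl
  rw [stableOrbitalIntegralRel_congr_of_eqOn (hB γ γ' hγ hc) f']

/-- **The ∃-form of (14.2.1) is patch-safe.** [cite: Rogawski1990, §14.2 (14.2.1) pp. 232–233] -/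
theorem IsInnerTransferExistsRel.iff_of_eqOn {corr : B → A → Prop} {stB : B → B → Prop} {stA : A → A → Prop} {regA : A → Prop}
    {m' m'₂ : OrbitalMeasureFamily B} {m m₂ : OrbitalMeasureFamily A}
    (hB : ∀ (γ : A) (γ' : B), regA γ → corr γ' γ → ∀ c : ConjClasses B, stB γ' (Quotient.out c) → m'₂ c = m' c)
    (hA : ∀ γ : A, regA γ → ∀ c : ConjClasses A, stA γ (Quotient.out c) → m₂ c = m c)
    (SmoothB : (B → ℂ) → Prop) (SmoothA : (A → ℂ) → Prop) :
    IsInnerTransferExistsRel corr stB stA regA m' m SmoothB SmoothA ↔ IsInnerTransferExistsRel corr stB stA regA m'₂ m₂ SmoothB SmoothA :=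
  forall_congr' fun f' => forall_congr' fun _ => exists_congr fun f => and_congr Iff.rfl (IsInnerTransferRel.iff_of_eqOn hB hA f' f)

/-- **(4.3.1) is PATCH-SAFE in the `G′`-family**: `Δ(a, out c) · Φ(m_G; c)` reads `m_G c` only where `R a (out c)` (★ `TransferFactorData.eq_zero_of_not_rel`),
so agreement at the classes `c` with `R a (out c)`, `regA a`, suffices. [cite: Rogawski1990, §4.3 (4.3.1) p. 43] -/
theorem IsDeltaTransferRel.iff_of_eqOn {R : A → B → Prop} {stA : A → A → Prop} {regA : A → Prop} (T : TransferFactorData A B R)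
    (mH : OrbitalMeasureFamily A) {mG mG₂ : OrbitalMeasureFamily B}
    (h : ∀ a : A, regA a → ∀ c : ConjClasses B, R a (Quotient.out c) → mG₂ c = mG c) (fH : A → ℂ) (f : B → ℂ) :
    IsDeltaTransferRel R stA regA T mH mG fH f ↔ IsDeltaTransferRel R stA regA T mH mG₂ fH f := by
  refine forall_congr' fun a => forall_congr' fun ha => ?_
  have hsum : (∑ᶠ c : ConjClasses B, T.Δ a (Quotient.out c) * classOrbitalIntegral mG₂ f c) =
      ∑ᶠ c : ConjClasses B, T.Δ a (Quotient.out c) * classOrbitalIntegral mG f c := by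
    refine finsum_congr fun c => ?_
    by_cases hc : R a (Quotient.out c)
    · rw [classOrbitalIntegral_congr_of_eq (h a ha c hc) f]
    · rw [T.eq_zero_of_not_rel a _ hc, zero_mul, zero_mul]
  rw [hsum]

/-- **The ∃-form of (4.3.1) ∕ Prop. 4.9.1 (a) is patch-safe** (same hypothesis). [cite: Rogawski1990, §4.9 Prop. 4.9.1 (a) p. 55] -/
theorem IsDeltaTransferExistsRel.iff_of_eqOn {R : A → B → Prop} {stA : A → A → Prop} {regA : A → Prop} (T : TransferFactorData A B R)
    (mH : OrbitalMeasureFamily A) {mG mG₂ : OrbitalMeasureFamily B}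
    (h : ∀ a : A, regA a → ∀ c : ConjClasses B, R a (Quotient.out c) → mG₂ c = mG c)
    (SmoothG : (B → ℂ) → Prop) (SmoothH : (A → ℂ) → Prop) :
    IsDeltaTransferExistsRel R stA regA T mH mG SmoothG SmoothH ↔ IsDeltaTransferExistsRel R stA regA T mH mG₂ SmoothG SmoothH :=
  forall_congr' fun f => forall_congr' fun _ => exists_congr fun fH => and_congr Iff.rfl (IsDeltaTransferRel.iff_of_eqOn T mH h fH f)

end Relations

end Literature.NumberTheory.Automorphic

/-! ## §2 The CM carriers: the line's regular-class pins at a finite place `v` and at `∞` -/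
namespace Literature.NumberTheory.Automorphic.UnitaryGroup
variable (L : Type) [Field L] [NumberField L] [IsCMField L] (H : Matrix (Fin 3) (Fin 3) L)

section Local

variable (v : HeightOneSpectrum (𝓞 ↥(maximalRealSubfield L)))
  [∀ a : ((cmDatum L 2 (Matrix.of fun i j : Fin 2 => if i.val + j.val + 1 = 2 then (1 : L) else 0)).Local v ×
      (cmDatum L 1 (Matrix.of fun i j : Fin 1 => if i.val + j.val + 1 = 1 then (1 : L) else 0)).Local v),
    MeasurableSpace (((cmDatum L 2 (Matrix.of fun i j : Fin 2 => if i.val + j.val + 1 = 2 then (1 : L) else 0)).Local v ×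
      (cmDatum L 1 (Matrix.of fun i j : Fin 1 => if i.val + j.val + 1 = 1 then (1 : L) else 0)).Local v) ⧸
      Subgroup.centralizer ({a} : Set ((cmDatum L 2 (Matrix.of fun i j : Fin 2 => if i.val + j.val + 1 = 2 then (1 : L) else 0)).Local v ×
      (cmDatum L 1 (Matrix.of fun i j : Fin 1 => if i.val + j.val + 1 = 1 then (1 : L) else 0)).Local v)))]
  [∀ γ : (cmDatum L 3 H).Local v, MeasurableSpace ((cmDatum L 3 H).Local v ⧸ Subgroup.centralizer ({γ} : Set ((cmDatum L 3 H).Local v)))]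

/-- **(4.3.1) at `v` is patch-safe**: two `G′_v`-families with the same REGULAR members have the same `Δ_v`-transfers. [cite: Rogawski1990, §4.3 (4.3.1) p. 43] -/
theorem isLocalDeltaTransfer_iff_of_eqOn_regular (T : LocalTransferFactor L H v)
    (mH : OrbitalMeasureFamily ((cmDatum L 2 (Matrix.of fun i j : Fin 2 => if i.val + j.val + 1 = 2 then (1 : L) else 0)).Local v ×
      (cmDatum L 1 (Matrix.of fun i j : Fin 1 => if i.val + j.val + 1 = 1 then (1 : L) else 0)).Local v))
    {mG mG₂ : OrbitalMeasureFamily ((cmDatum L 3 H).Local v)}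
    (h : ∀ c : ConjClasses ((cmDatum L 3 H).Local v), IsRegularElt ((Quotient.out c).val : GL (Fin 3) (LocalRing L v)) → mG₂ c = mG c)
    (fH : ((cmDatum L 2 (Matrix.of fun i j : Fin 2 => if i.val + j.val + 1 = 2 then (1 : L) else 0)).Local v ×
      (cmDatum L 1 (Matrix.of fun i j : Fin 1 => if i.val + j.val + 1 = 1 then (1 : L) else 0)).Local v) → ℂ)
    (f : (cmDatum L 3 H).Local v → ℂ) :
    IsLocalDeltaTransfer L H v T mH mG fH f ↔ IsLocalDeltaTransfer L H v T mH mG₂ fH f :=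
  IsDeltaTransferRel.iff_of_eqOn T mH (fun _ ha c hc => h c (isRegularElt_of_isLocalNormPair (L := L) (H' := H) (v := v) hc ha)) fH f

/-- **Prop. 4.9.1 (a) at `v` as a relation is patch-safe.** [cite: Rogawski1990, §4.9 Prop. 4.9.1 (a) p. 55] -/
theorem isLocalDeltaTransferExists_iff_of_eqOn_regular (T : LocalTransferFactor L H v)
    (mH : OrbitalMeasureFamily ((cmDatum L 2 (Matrix.of fun i j : Fin 2 => if i.val + j.val + 1 = 2 then (1 : L) else 0)).Local v ×
      (cmDatum L 1 (Matrix.of fun i j : Fin 1 => if i.val + j.val + 1 = 1 then (1 : L) else 0)).Local v))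
    {mG mG₂ : OrbitalMeasureFamily ((cmDatum L 3 H).Local v)}
    (h : ∀ c : ConjClasses ((cmDatum L 3 H).Local v), IsRegularElt ((Quotient.out c).val : GL (Fin 3) (LocalRing L v)) → mG₂ c = mG c)
    (Smooth' : ((cmDatum L 3 H).Local v → ℂ) → Prop)
    (SmoothH : (((cmDatum L 2 (Matrix.of fun i j : Fin 2 => if i.val + j.val + 1 = 2 then (1 : L) else 0)).Local v ×
      (cmDatum L 1 (Matrix.of fun i j : Fin 1 => if i.val + j.val + 1 = 1 then (1 : L) else 0)).Local v) → ℂ) → Prop) :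
    IsLocalDeltaTransferExists L H v T mH mG Smooth' SmoothH ↔ IsLocalDeltaTransferExists L H v T mH mG₂ Smooth' SmoothH :=
  IsDeltaTransferExistsRel.iff_of_eqOn T mH (fun _ ha c hc => h c (isRegularElt_of_isLocalNormPair (L := L) (H' := H) (v := v) hc ha)) Smooth' SmoothH

/-- **The per-`v` transfer datum (xi′) is patch-safe** (nondegeneracy and the `H`-side untouched). [cite: Rogawski1990, §4.9 Prop. 4.9.1 (a) p. 55] -/
theorem isLocalTransferDatum_of_eqOn_regular (T : LocalTransferFactor L H v)
    (mH : OrbitalMeasureFamily ((cmDatum L 2 (Matrix.of fun i j : Fin 2 => if i.val + j.val + 1 = 2 then (1 : L) else 0)).Local v ×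
      (cmDatum L 1 (Matrix.of fun i j : Fin 1 => if i.val + j.val + 1 = 1 then (1 : L) else 0)).Local v))
    {mG mG₂ : OrbitalMeasureFamily ((cmDatum L 3 H).Local v)}
    (h : ∀ c : ConjClasses ((cmDatum L 3 H).Local v), IsRegularElt ((Quotient.out c).val : GL (Fin 3) (LocalRing L v)) → mG₂ c = mG c)
    (hT : IsLocalTransferDatum L H v T mH mG) : IsLocalTransferDatum L H v T mH mG₂ :=
  ⟨hT.1, hT.2.1, OrbitalMeasureFamily.isAdmissibleOn_of_eqOn h hT.2.2.1,
    (isLocalDeltaTransferExists_iff_of_eqOn_regular L H v T mH h _ _).1 hT.2.2.2⟩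

/-- **The unit fundamental lemma at `v` (Prop. 4.9.1 (b)) is patch-safe.** [cite: Rogawski1990, §4.9 Prop. 4.9.1 (b) p. 55] -/
theorem isLocalUnitTransfer_of_eqOn_regular (T : LocalTransferFactor L H v)
    (mH : OrbitalMeasureFamily ((cmDatum L 2 (Matrix.of fun i j : Fin 2 => if i.val + j.val + 1 = 2 then (1 : L) else 0)).Local v ×
      (cmDatum L 1 (Matrix.of fun i j : Fin 1 => if i.val + j.val + 1 = 1 then (1 : L) else 0)).Local v))
    {mG mG₂ : OrbitalMeasureFamily ((cmDatum L 3 H).Local v)}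
    (h : ∀ c : ConjClasses ((cmDatum L 3 H).Local v), IsRegularElt ((Quotient.out c).val : GL (Fin 3) (LocalRing L v)) → mG₂ c = mG c)
    (hT : IsLocalUnitTransfer L H v T mH mG) : IsLocalUnitTransfer L H v T mH mG₂ :=
  (isLocalDeltaTransfer_iff_of_eqOn_regular L H v T mH h _ _).1 hT

end Local

section ArchInner

variable
  [∀ γ : arch (↥(maximalRealSubfield L)) L (IsCMField.complexConj L) 3 H,
    MeasurableSpace (arch (↥(maximalRealSubfield L)) L (IsCMField.complexConj L) 3 H ⧸
      Subgroup.centralizer ({γ} : Set (arch (↥(maximalRealSubfield L)) L (IsCMField.complexConj L) 3 H)))]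
  [∀ γ : arch (↥(maximalRealSubfield L)) L (IsCMField.complexConj L) 3 (Matrix.of fun i j : Fin 3 => if i.val + j.val + 1 = 3 then (1 : L) else 0),
    MeasurableSpace (arch (↥(maximalRealSubfield L)) L (IsCMField.complexConj L) 3 (Matrix.of fun i j : Fin 3 => if i.val + j.val + 1 = 3 then (1 : L) else 0) ⧸
      Subgroup.centralizer ({γ} : Set (arch (↥(maximalRealSubfield L)) L (IsCMField.complexConj L) 3 (Matrix.of fun i j : Fin 3 => if i.val + j.val + 1 = 3 then (1 : L) else 0))))]

/-- **(14.2.1) at `∞` is patch-safe**: pairs of families with the same REGULAR members have the same inner transfers. [cite: Rogawski1990, §14.2 (14.2.1) p. 232] -/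
theorem isArchInnerTransfer_iff_of_eqOn_regular
    {m' m'₂ : OrbitalMeasureFamily (arch (↥(maximalRealSubfield L)) L (IsCMField.complexConj L) 3 H)}
    {m m₂ : OrbitalMeasureFamily (arch (↥(maximalRealSubfield L)) L (IsCMField.complexConj L) 3 (Matrix.of fun i j : Fin 3 => if i.val + j.val + 1 = 3 then (1 : L) else 0))}
    (h' : ∀ c : ConjClasses (arch (↥(maximalRealSubfield L)) L (IsCMField.complexConj L) 3 H),
      IsRegularElt ((Quotient.out c).val : GL (Fin 3) (mixedEmbedding.mixedSpace L)) → m'₂ c = m' c)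
    (h : ∀ c : ConjClasses (arch (↥(maximalRealSubfield L)) L (IsCMField.complexConj L) 3 (Matrix.of fun i j : Fin 3 => if i.val + j.val + 1 = 3 then (1 : L) else 0)),
      IsRegularElt ((Quotient.out c).val : GL (Fin 3) (mixedEmbedding.mixedSpace L)) → m₂ c = m c)
    (a' : arch (↥(maximalRealSubfield L)) L (IsCMField.complexConj L) 3 H → ℂ)
    (a : arch (↥(maximalRealSubfield L)) L (IsCMField.complexConj L) 3 (Matrix.of fun i j : Fin 3 => if i.val + j.val + 1 = 3 then (1 : L) else 0) → ℂ) :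
    IsArchInnerTransfer L H m' m a' a ↔ IsArchInnerTransfer L H m'₂ m₂ a' a :=
  IsInnerTransferRel.iff_of_eqOn
    (fun _ _ hγ hc c hst => h' c (hst.isRegularElt_iff.1 ((isRegularElt_iff_of_corresponds hc).2 hγ)))
    (fun _ hγ c hst => h c (hst.isRegularElt_iff.1 hγ)) a' a

/-- **«the existence of `f_v`, `v ∈ S₀`» at `∞` as a relation is patch-safe.** [cite: Rogawski1990, §14.2 (14.2.1) pp. 232–233] -/
theorem isArchInnerTransferExists_iff_of_eqOn_regular
    {m' m'₂ : OrbitalMeasureFamily (arch (↥(maximalRealSubfield L)) L (IsCMField.complexConj L) 3 H)}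
    {m m₂ : OrbitalMeasureFamily (arch (↥(maximalRealSubfield L)) L (IsCMField.complexConj L) 3 (Matrix.of fun i j : Fin 3 => if i.val + j.val + 1 = 3 then (1 : L) else 0))}
    (h' : ∀ c : ConjClasses (arch (↥(maximalRealSubfield L)) L (IsCMField.complexConj L) 3 H),
      IsRegularElt ((Quotient.out c).val : GL (Fin 3) (mixedEmbedding.mixedSpace L)) → m'₂ c = m' c)
    (h : ∀ c : ConjClasses (arch (↥(maximalRealSubfield L)) L (IsCMField.complexConj L) 3 (Matrix.of fun i j : Fin 3 => if i.val + j.val + 1 = 3 then (1 : L) else 0)),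
      IsRegularElt ((Quotient.out c).val : GL (Fin 3) (mixedEmbedding.mixedSpace L)) → m₂ c = m c)
    (Smooth' : (arch (↥(maximalRealSubfield L)) L (IsCMField.complexConj L) 3 H → ℂ) → Prop)
    (Smooth : (arch (↥(maximalRealSubfield L)) L (IsCMField.complexConj L) 3 (Matrix.of fun i j : Fin 3 => if i.val + j.val + 1 = 3 then (1 : L) else 0) → ℂ) → Prop) :
    IsArchInnerTransferExists L H m' m Smooth' Smooth ↔ IsArchInnerTransferExists L H m'₂ m₂ Smooth' Smooth :=
  IsInnerTransferExistsRel.iff_of_eqOn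
    (fun _ _ hγ hc c hst => h' c (hst.isRegularElt_iff.1 ((isRegularElt_iff_of_corresponds hc).2 hγ)))
    (fun _ hγ c hst => h c (hst.isRegularElt_iff.1 hγ)) Smooth' Smooth

end ArchInner

section ArchDelta

variable
  [∀ γ : arch (↥(maximalRealSubfield L)) L (IsCMField.complexConj L) 3 H,
    MeasurableSpace (arch (↥(maximalRealSubfield L)) L (IsCMField.complexConj L) 3 H ⧸
      Subgroup.centralizer ({γ} : Set (arch (↥(maximalRealSubfield L)) L (IsCMField.complexConj L) 3 H)))]
  [∀ a : (arch (↥(maximalRealSubfield L)) L (IsCMField.complexConj L) 2 (Matrix.of fun i j : Fin 2 => if i.val + j.val + 1 = 2 then (1 : L) else 0) ×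
      arch (↥(maximalRealSubfield L)) L (IsCMField.complexConj L) 1 (Matrix.of fun i j : Fin 1 => if i.val + j.val + 1 = 1 then (1 : L) else 0)),
    MeasurableSpace ((arch (↥(maximalRealSubfield L)) L (IsCMField.complexConj L) 2 (Matrix.of fun i j : Fin 2 => if i.val + j.val + 1 = 2 then (1 : L) else 0) ×
      arch (↥(maximalRealSubfield L)) L (IsCMField.complexConj L) 1 (Matrix.of fun i j : Fin 1 => if i.val + j.val + 1 = 1 then (1 : L) else 0)) ⧸
      Subgroup.centralizer ({a} : Set (arch (↥(maximalRealSubfield L)) L (IsCMField.complexConj L) 2 (Matrix.of fun i j : Fin 2 => if i.val + j.val + 1 = 2 then (1 : L) else 0) ×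
      arch (↥(maximalRealSubfield L)) L (IsCMField.complexConj L) 1 (Matrix.of fun i j : Fin 1 => if i.val + j.val + 1 = 1 then (1 : L) else 0))))]

/-- **§14.3's Δ′_∞-transfer relation is patch-safe in the `G′_∞`-family.** [cite: Rogawski1990, §14.3 pp. 233–234] -/
theorem isArchDeltaTransfer_iff_of_eqOn_regular (T : ArchTransferFactor L H)
    (mH : OrbitalMeasureFamily (arch (↥(maximalRealSubfield L)) L (IsCMField.complexConj L) 2 (Matrix.of fun i j : Fin 2 => if i.val + j.val + 1 = 2 then (1 : L) else 0) ×
      arch (↥(maximalRealSubfield L)) L (IsCMField.complexConj L) 1 (Matrix.of fun i j : Fin 1 => if i.val + j.val + 1 = 1 then (1 : L) else 0)))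
    {mG mG₂ : OrbitalMeasureFamily (arch (↥(maximalRealSubfield L)) L (IsCMField.complexConj L) 3 H)}
    (h : ∀ c : ConjClasses (arch (↥(maximalRealSubfield L)) L (IsCMField.complexConj L) 3 H),
      IsRegularElt ((Quotient.out c).val : GL (Fin 3) (mixedEmbedding.mixedSpace L)) → mG₂ c = mG c)
    (aH : (arch (↥(maximalRealSubfield L)) L (IsCMField.complexConj L) 2 (Matrix.of fun i j : Fin 2 => if i.val + j.val + 1 = 2 then (1 : L) else 0) ×
      arch (↥(maximalRealSubfield L)) L (IsCMField.complexConj L) 1 (Matrix.of fun i j : Fin 1 => if i.val + j.val + 1 = 1 then (1 : L) else 0)) → ℂ)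
    (a : arch (↥(maximalRealSubfield L)) L (IsCMField.complexConj L) 3 H → ℂ) :
    IsArchDeltaTransfer L H T mH mG aH a ↔ IsArchDeltaTransfer L H T mH mG₂ aH a :=
  IsDeltaTransferRel.iff_of_eqOn T mH (fun _ ha c hc => h c (isRegularElt_of_isArchNormPair (L := L) (H' := H) hc ha)) aH a

/-- **«the existence of `f′^H_v`, `v ∈ S₀`» at `∞` as a relation is patch-safe in the `G′_∞`-family.** [cite: Rogawski1990, §14.3 p. 234] -/
theorem isArchDeltaTransferExists_iff_of_eqOn_regular (T : ArchTransferFactor L H)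
    (mH : OrbitalMeasureFamily (arch (↥(maximalRealSubfield L)) L (IsCMField.complexConj L) 2 (Matrix.of fun i j : Fin 2 => if i.val + j.val + 1 = 2 then (1 : L) else 0) ×
      arch (↥(maximalRealSubfield L)) L (IsCMField.complexConj L) 1 (Matrix.of fun i j : Fin 1 => if i.val + j.val + 1 = 1 then (1 : L) else 0)))
    {mG mG₂ : OrbitalMeasureFamily (arch (↥(maximalRealSubfield L)) L (IsCMField.complexConj L) 3 H)}
    (h : ∀ c : ConjClasses (arch (↥(maximalRealSubfield L)) L (IsCMField.complexConj L) 3 H),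
      IsRegularElt ((Quotient.out c).val : GL (Fin 3) (mixedEmbedding.mixedSpace L)) → mG₂ c = mG c)
    (Smooth' : (arch (↥(maximalRealSubfield L)) L (IsCMField.complexConj L) 3 H → ℂ) → Prop)
    (SmoothH : ((arch (↥(maximalRealSubfield L)) L (IsCMField.complexConj L) 2 (Matrix.of fun i j : Fin 2 => if i.val + j.val + 1 = 2 then (1 : L) else 0) ×
      arch (↥(maximalRealSubfield L)) L (IsCMField.complexConj L) 1 (Matrix.of fun i j : Fin 1 => if i.val + j.val + 1 = 1 then (1 : L) else 0)) → ℂ) → Prop) :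
    IsArchDeltaTransferExists L H T mH mG Smooth' SmoothH ↔ IsArchDeltaTransferExists L H T mH mG₂ Smooth' SmoothH :=
  IsDeltaTransferExistsRel.iff_of_eqOn T mH (fun _ ha c hc => h c (isRegularElt_of_isArchNormPair (L := L) (H' := H) hc ha)) Smooth' SmoothH

end ArchDelta

/-! ## §3 The four family riders (ix-adm)(ix-admA)(ix-admAq)(ix-norm) at a NON-regular rational `γ₀` for a patched family, from the singular members
The local ∕ archimedean stable class of a non-regular `γ₀` consists of non-regular classes (★ `isRegularElt_iff_of_corresponds`, `Polynomial.separable_map`), so the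
closer's riders (A-p16 (g21) v5 :842–:856) for the patched family ARE the (ADM)(NORM) clauses of ★ `Rogawski1990.SingularEllipticTransfer` for `m_s`. -/

section Riders
variable {N : ℕ} {H₀ : Matrix (Fin N) (Fin N) L}

/-- **`γ₀` non-regular ⇒ `(γ₀)_v` non-regular** (separability descends along `L → L ⊗ L⁺_v`). [cite: Rogawski1990, §3.1 p. 19; §14.2 p. 232] -/
theorem not_isRegularElt_toLocal_toAdelic (γ₀ : (cmDatum L N H₀).Rational) (hnreg : ¬ IsRegularElt (γ₀.val : GL (Fin N) L))
    (v : HeightOneSpectrum (𝓞 ↥(maximalRealSubfield L))) :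
    ¬ IsRegularElt ((((cmDatum L N H₀).toLocal v ((cmDatum L N H₀).toAdelic γ₀))).val : GL (Fin N) (LocalRing L v)) := fun h => by
  apply hnreg
  rw [isRegularElt_iff] at h ⊢
  rw [coe_cmDatum_toLocal_toAdelic, coe_toLocalGL_apply, Matrix.charpoly_map] at h
  exact (Polynomial.separable_map _).1 h

/-- **`γ₀` non-regular ⇒ `γ₀ ⊗ 1 ∈ U(H)(L ⊗ ℝ)` non-regular** (★ `charpoly_cmRationalToArch_eq_map`). [cite: Rogawski1990, §3.1 p. 19; §14.3 p. 234] -/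
theorem not_isRegularElt_cmRationalToArch (γ₀ : (cmDatum L N H₀).Rational) (hnreg : ¬ IsRegularElt (γ₀.val : GL (Fin N) L)) :
    ¬ IsRegularElt ((cmRationalToArch L N H₀ γ₀).val : GL (Fin N) (mixedEmbedding.mixedSpace L)) := fun h => by
  apply hnreg
  rw [isRegularElt_iff] at h ⊢
  rw [charpoly_cmRationalToArch_eq_map] at h
  exact (Polynomial.separable_map _).1 h

section RidersLocal

variable
  [∀ (v : HeightOneSpectrum (𝓞 ↥(maximalRealSubfield L))) (x : (cmDatum L N H₀).Local v),
    MeasurableSpace ((cmDatum L N H₀).Local v ⧸ Subgroup.centralizer ({x} : Set ((cmDatum L N H₀).Local v)))]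

/-- **(ix-adm) for a patched family**: at a non-regular `γ₀`, admissibility on the local stable class of `(γ₀)_v` passes from `m_s` to any family agreeing with it
off the regular classes. [cite: Rogawski1990, §14.2 (14.2.1) p. 232; §4.3 p. 43] -/
theorem isAdmissibleOn_corresponds_local_of_eqOn_not_regular (v : HeightOneSpectrum (𝓞 ↥(maximalRealSubfield L)))
    {mGs mG₂ : OrbitalMeasureFamily ((cmDatum L N H₀).Local v)}
    (h : ∀ c : ConjClasses ((cmDatum L N H₀).Local v), ¬ IsRegularElt ((Quotient.out c).val : GL (Fin N) (LocalRing L v)) → mG₂ c = mGs c)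
    (γ₀ : (cmDatum L N H₀).Rational) (hnreg : ¬ IsRegularElt (γ₀.val : GL (Fin N) L))
    (hadm : mGs.IsAdmissibleOn fun x : (cmDatum L N H₀).Local v =>
      Corresponds (conjLocal L (IsCMField.complexConj L) v) ((adelicForm L N H₀).map (adeleToLocal L v)) ((adelicForm L N H₀).map (adeleToLocal L v))
        ((cmDatum L N H₀).toLocal v ((cmDatum L N H₀).toAdelic γ₀)) x) :
    mG₂.IsAdmissibleOn fun x : (cmDatum L N H₀).Local v =>
      Corresponds (conjLocal L (IsCMField.complexConj L) v) ((adelicForm L N H₀).map (adeleToLocal L v)) ((adelicForm L N H₀).map (adeleToLocal L v))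
        ((cmDatum L N H₀).toLocal v ((cmDatum L N H₀).toAdelic γ₀)) x :=
  OrbitalMeasureFamily.isAdmissibleOn_of_eqOn
    (fun c hc => h c fun hreg => not_isRegularElt_toLocal_toAdelic L γ₀ hnreg v ((isRegularElt_iff_of_corresponds hc).2 hreg)) hadm

/-- **(ix-norm) for a patched family**: normalisation off a finite set at a non-regular `γ₀` passes from `m_s` to any family agreeing with it off the regular
classes (★ `isNormalisedOff_congr_point`, ★ `isRegularElt_iff_of_isConj_local`). [cite: Rogawski1990, §4.3 pp. 43–44] -/
theorem exists_isNormalisedOff_of_eqOn_not_regular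
    {mGs mG₂ : ∀ v : HeightOneSpectrum (𝓞 ↥(maximalRealSubfield L)), OrbitalMeasureFamily ((cmDatum L N H₀).Local v)}
    (h : ∀ v (c : ConjClasses ((cmDatum L N H₀).Local v)), ¬ IsRegularElt ((Quotient.out c).val : GL (Fin N) (LocalRing L v)) → mG₂ v c = mGs v c)
    (γ₀ : (cmDatum L N H₀).Rational) (hnreg : ¬ IsRegularElt (γ₀.val : GL (Fin N) L))
    (hnorm : ∃ S₀ : Finset (HeightOneSpectrum (𝓞 ↥(maximalRealSubfield L))), IsNormalisedOff L N H₀ mGs ((cmDatum L N H₀).toAdelic γ₀) S₀) :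
    ∃ S₀ : Finset (HeightOneSpectrum (𝓞 ↥(maximalRealSubfield L))), IsNormalisedOff L N H₀ mG₂ ((cmDatum L N H₀).toAdelic γ₀) S₀ := by
  obtain ⟨S₀, hS₀⟩ := hnorm
  exact ⟨S₀, isNormalisedOff_congr_point L mGs mG₂ _ S₀
    (fun v => h v _ fun hreg => not_isRegularElt_toLocal_toAdelic L γ₀ hnreg v
      ((isRegularElt_iff_of_isConj_local L H₀ v (isConj_out_conjClasses_mk _)).2 hreg)) hS₀⟩

end RidersLocal

section RidersArch

variable
  [∀ a : arch (↥(maximalRealSubfield L)) L (IsCMField.complexConj L) N H₀,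
    MeasurableSpace (arch (↥(maximalRealSubfield L)) L (IsCMField.complexConj L) N H₀ ⧸ Subgroup.centralizer ({a} : Set (arch (↥(maximalRealSubfield L)) L (IsCMField.complexConj L) N H₀)))]

/-- **(ix-admA) for a patched family on `G′_∞`**: the same at the archimedean stable class of `γ₀ ⊗ 1`. [cite: Rogawski1990, §14.2 (14.2.1) pp. 232–233] -/
theorem isAdmissibleOn_corresponds_arch_of_eqOn_not_regular
    {mGis mGi₂ : OrbitalMeasureFamily (arch (↥(maximalRealSubfield L)) L (IsCMField.complexConj L) N H₀)}
    (h : ∀ c : ConjClasses (arch (↥(maximalRealSubfield L)) L (IsCMField.complexConj L) N H₀),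
      ¬ IsRegularElt ((Quotient.out c).val : GL (Fin N) (mixedEmbedding.mixedSpace L)) → mGi₂ c = mGis c)
    (γ₀ : (cmDatum L N H₀).Rational) (hnreg : ¬ IsRegularElt (γ₀.val : GL (Fin N) L))
    (hadm : mGis.IsAdmissibleOn fun x : arch (↥(maximalRealSubfield L)) L (IsCMField.complexConj L) N H₀ =>
      Corresponds (conjMixed (↥(maximalRealSubfield L)) L (IsCMField.complexConj L)) (archFormOf L N H₀) (archFormOf L N H₀) (cmRationalToArch L N H₀ γ₀) x) :
    mGi₂.IsAdmissibleOn fun x : arch (↥(maximalRealSubfield L)) L (IsCMField.complexConj L) N H₀ =>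
      Corresponds (conjMixed (↥(maximalRealSubfield L)) L (IsCMField.complexConj L)) (archFormOf L N H₀) (archFormOf L N H₀) (cmRationalToArch L N H₀ γ₀) x :=
  OrbitalMeasureFamily.isAdmissibleOn_of_eqOn
    (fun c hc => h c fun hreg => not_isRegularElt_cmRationalToArch L γ₀ hnreg ((isRegularElt_iff_of_corresponds hc).2 hreg)) hadm

end RidersArch

section RidersArchQuasiSplit

variable {H₁ : Matrix (Fin N) (Fin N) L}
  [∀ a : arch (↥(maximalRealSubfield L)) L (IsCMField.complexConj L) N H₁,
    MeasurableSpace (arch (↥(maximalRealSubfield L)) L (IsCMField.complexConj L) N H₁ ⧸ Subgroup.centralizer ({a} : Set (arch (↥(maximalRealSubfield L)) L (IsCMField.complexConj L) N H₁)))]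

/-- **(ix-admAq) for a patched family on another form `G_∞ = U(H₁)_∞`** (the quasi-split `U(Φ₃)_∞` in the line): the same at the classes of `U(H₁)_∞`
corresponding to `γ₀ ⊗ 1`. [cite: Rogawski1990, §14.2 (14.2.1) pp. 232–233] -/
theorem isAdmissibleOn_corresponds_arch_of_eqOn_not_regular'
    {mqis mqi₂ : OrbitalMeasureFamily (arch (↥(maximalRealSubfield L)) L (IsCMField.complexConj L) N H₁)}
    (h : ∀ c : ConjClasses (arch (↥(maximalRealSubfield L)) L (IsCMField.complexConj L) N H₁),
      ¬ IsRegularElt ((Quotient.out c).val : GL (Fin N) (mixedEmbedding.mixedSpace L)) → mqi₂ c = mqis c)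
    (γ₀ : (cmDatum L N H₀).Rational) (hnreg : ¬ IsRegularElt (γ₀.val : GL (Fin N) L))
    (hadm : mqis.IsAdmissibleOn fun x : arch (↥(maximalRealSubfield L)) L (IsCMField.complexConj L) N H₁ =>
      Corresponds (conjMixed (↥(maximalRealSubfield L)) L (IsCMField.complexConj L)) (archFormOf L N H₀) (archFormOf L N H₁) (cmRationalToArch L N H₀ γ₀) x) :
    mqi₂.IsAdmissibleOn fun x : arch (↥(maximalRealSubfield L)) L (IsCMField.complexConj L) N H₁ =>
      Corresponds (conjMixed (↥(maximalRealSubfield L)) L (IsCMField.complexConj L)) (archFormOf L N H₀) (archFormOf L N H₁) (cmRationalToArch L N H₀ γ₀) x :=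
  OrbitalMeasureFamily.isAdmissibleOn_of_eqOn
    (fun c hc => h c fun hreg => not_isRegularElt_cmRationalToArch L γ₀ hnreg ((isRegularElt_iff_of_corresponds hc).2 hreg)) hadm

end RidersArchQuasiSplit

end Riders

end Literature.NumberTheory.Automorphic.UnitaryGroup
end
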